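import Mathlib.AlgebraicGeometry.EllipticCurve.VariableChange
import HarnessLib

/-! # The flex normal form from a root of `Ψ₃` — stub `stub_flexAlgebra` of line `Sketch`,
# crux `MazurKenkuBound` (stmt-ABC-15125)

WHAT. Over a field, let `P = (x₀, y₀)` lie on the Weierstrass curve `W` with
`Ψ₃(x₀) = 3x₀⁴ + b₂x₀³ + 3b₄x₀² + 3b₆x₀ + b₈ = 0` (the `3`-division polynomial: `P` is a flex) and
`Δ(W) ≠ 0`. Then `D := 2y₀ + a₁x₀ + a₃ ≠ 0` (a flex is not `2`-torsion), and for the tangent slope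
`s` — a root of the monic `s² + a₁s − a₂ − 3x₀` — the change of variables `(1, x₀, s, y₀)` gives
the FLEX FORM `y² + a₁'xy + a₃'y = x³`, i.e. `a₂' = a₄' = a₆' = 0` (Silverman, *AEC* III.1 and
Ex. 3.7). The assembly stub `stub_potGoodTwo` of the line builds the good-reduction twist at `2`
from this model.

PROOF (Mathlib's `variableChange_*` formulae with `u = 1`, `r = x₀`, `t = y₀`). For EVERY `s`:
`b₈' = b₈ + 3x₀b₆ + 3x₀²b₄ + x₀³b₂ + 3x₀⁴ = Ψ₃(x₀) = 0`, `a₆' = 0` is the curve equation at `P`,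
`a₃' = D` and `a₄' = N − sD` with `N := 3x₀² + 2a₂x₀ + a₄ − a₁y₀`.
* `D ≠ 0`: if `D = 0`, take `s = 0`; then `a₃' = a₆' = 0` and `0 = b₈' = −a₄'²` give `a₄' = 0`,
  whence `b₄' = b₆' = b₈' = 0` and `Δ = Δ' = 0`, absurd.
* With `D ≠ 0` take `s := N / D`: `a₄' = 0`, `a₆' = 0`, and `0 = b₈' = a₂'a₃'² = a₂'D²` forces
  `a₂' = 0`; the monic relation is `−a₂' = s² + a₁s − a₂ − 3x₀ = 0`.
-/

-- `Summit.<Summit>.<Problem>` is the mandated summit-side namespace (CONVENTIONS §2); for the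
-- single-conjunct summit `ABC` the two coincide, so the duplicate `ABC.ABC` is deliberate.
set_option linter.dupNamespace false

noncomputable section

open WeierstrassCurve

namespace Summit.ABC.ABC.Theorems

section shift

variable {R : Type*} [CommRing R] (W : WeierstrassCurve R) (r s t : R)

/-- `a₂` of `(1, r, s, t) • W`: `a₂ − sa₁ + 3r − s²` (Silverman, *AEC* III.1, Table 3.1 with
`u = 1`). [folklore] -/
theorem shift_variableChange_a₂ :
    ((⟨1, r, s, t⟩ : VariableChange R) • W).a₂ = W.a₂ - s * W.a₁ + 3 * r - s ^ 2 := by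
  simp only [variableChange_a₂, Units.val_one, inv_one, one_pow, one_mul]

/-- `a₃` of `(1, r, s, t) • W`: `a₃ + ra₁ + 2t` (Silverman, *AEC* III.1, Table 3.1 with `u = 1`).
[folklore] -/
theorem shift_variableChange_a₃ :
    ((⟨1, r, s, t⟩ : VariableChange R) • W).a₃ = W.a₃ + r * W.a₁ + 2 * t := by
  simp only [variableChange_a₃, Units.val_one, inv_one, one_pow, one_mul]

/-- `a₄` of `(1, r, s, t) • W`: `a₄ − sa₃ + 2ra₂ − (t + rs)a₁ + 3r² − 2st` (Silverman, *AEC* III.1,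
Table 3.1 with `u = 1`). [folklore] -/
theorem shift_variableChange_a₄ :
    ((⟨1, r, s, t⟩ : VariableChange R) • W).a₄ =
      W.a₄ - s * W.a₃ + 2 * r * W.a₂ - (t + r * s) * W.a₁ + 3 * r ^ 2 - 2 * s * t := by
  simp only [variableChange_a₄, Units.val_one, inv_one, one_pow, one_mul]

/-- `a₆` of `(1, r, s, t) • W`: `a₆ + ra₄ + r²a₂ + r³ − ta₃ − t² − rta₁` (Silverman, *AEC* III.1,
Table 3.1 with `u = 1`). [folklore] -/
theorem shift_variableChange_a₆ :
    ((⟨1, r, s, t⟩ : VariableChange R) • W).a₆ =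
      W.a₆ + r * W.a₄ + r ^ 2 * W.a₂ + r ^ 3 - t * W.a₃ - t ^ 2 - r * t * W.a₁ := by
  simp only [variableChange_a₆, Units.val_one, inv_one, one_pow, one_mul]

/-- `b₈` of `(1, r, s, t) • W` is `Ψ₃(r) = 3r⁴ + b₂r³ + 3b₄r² + 3b₆r + b₈`, independently of `s, t`
(Silverman, *AEC* III.1, Table 3.1 with `u = 1`). [folklore] -/
theorem shift_variableChange_b₈ :
    ((⟨1, r, s, t⟩ : VariableChange R) • W).b₈ =
      W.b₈ + 3 * r * W.b₆ + 3 * r ^ 2 * W.b₄ + r ^ 3 * W.b₂ + 3 * r ^ 4 := by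
  simp only [variableChange_b₈, Units.val_one, inv_one, one_pow, one_mul]

/-- `Δ` is unchanged by `(1, r, s, t)` (Silverman, *AEC* III.1, Table 3.1 with `u = 1`).
[folklore] -/
theorem shift_variableChange_Δ : ((⟨1, r, s, t⟩ : VariableChange R) • W).Δ = W.Δ := by
  simp only [variableChange_Δ, Units.val_one, inv_one, one_pow, one_mul]

/-- Centring at a point of the curve kills `a₆`: if `(x₀, y₀)` satisfies the Weierstrass equation
of `W` then `((1, x₀, s, y₀) • W).a₆ = 0` for every `s`. [folklore] -/
theorem shift_variableChange_a₆_eq_zero (x₀ y₀ : R)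
    (hE : y₀ ^ 2 + W.a₁ * x₀ * y₀ + W.a₃ * y₀ = x₀ ^ 3 + W.a₂ * x₀ ^ 2 + W.a₄ * x₀ + W.a₆) :
    ((⟨1, x₀, s, y₀⟩ : VariableChange R) • W).a₆ = 0 := by
  rw [shift_variableChange_a₆]
  linear_combination -hE

/-- Centring at a root `x₀` of `Ψ₃ = 3x⁴ + b₂x³ + 3b₄x² + 3b₆x + b₈` kills `b₈`:
`((1, x₀, s, t) • W).b₈ = Ψ₃(x₀) = 0` for every `s, t`. [folklore] -/
theorem shift_variableChange_b₈_eq_zero (x₀ : R)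
    (hΨ : 3 * x₀ ^ 4 + W.b₂ * x₀ ^ 3 + 3 * W.b₄ * x₀ ^ 2 + 3 * W.b₆ * x₀ + W.b₈ = 0) :
    ((⟨1, x₀, s, t⟩ : VariableChange R) • W).b₈ = 0 := by
  rw [shift_variableChange_b₈]
  linear_combination hΨ

end shift

/-- A Weierstrass curve over a field with `a₃ = a₆ = 0` and `b₈ = 0` is singular: `b₈ = −a₄²`
forces `a₄ = 0`, and then `b₄ = b₆ = b₈ = 0`, so `Δ = 0`. [folklore] -/
private theorem Δ_eq_zero_of_a₃_a₆_b₈ {F : Type*} [Field F] {V : WeierstrassCurve F}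
    (h3 : V.a₃ = 0) (h6 : V.a₆ = 0) (h8 : V.b₈ = 0) : V.Δ = 0 := by
  have h4 : V.a₄ = 0 := by
    have hb : V.a₁ ^ 2 * V.a₆ + 4 * V.a₂ * V.a₆ - V.a₁ * V.a₃ * V.a₄ + V.a₂ * V.a₃ ^ 2
        - V.a₄ ^ 2 = 0 := h8
    rw [h3, h6] at hb
    have hsq : V.a₄ ^ 2 = 0 := by linear_combination -hb
    exact sq_eq_zero_iff.mp hsq
  simp only [WeierstrassCurve.Δ, WeierstrassCurve.b₂, WeierstrassCurve.b₄, WeierstrassCurve.b₆,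
    WeierstrassCurve.b₈, h3, h4, h6]
  ring

/-- A Weierstrass curve over a field with `a₄ = a₆ = 0`, `b₈ = 0` and `a₃ ≠ 0` has `a₂ = 0`:
`b₈ = a₂a₃²`. [folklore] -/
private theorem a₂_eq_zero_of_a₄_a₆_b₈ {F : Type*} [Field F] {V : WeierstrassCurve F}
    (h3 : V.a₃ ≠ 0) (h4 : V.a₄ = 0) (h6 : V.a₆ = 0) (h8 : V.b₈ = 0) : V.a₂ = 0 := by
  have hb : V.a₁ ^ 2 * V.a₆ + 4 * V.a₂ * V.a₆ - V.a₁ * V.a₃ * V.a₄ + V.a₂ * V.a₃ ^ 2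
      - V.a₄ ^ 2 = 0 := h8
  rw [h4, h6] at hb
  have hmul : V.a₂ * V.a₃ ^ 2 = 0 := by linear_combination hb
  rcases mul_eq_zero.mp hmul with h | h
  · exact h
  · exact absurd (sq_eq_zero_iff.mp h) h3

/-- **The flex normal form** (registered stub `stub_flexAlgebra` of line `Sketch`, crux
stmt-ABC-15125). Over a field of characteristic zero, let `(x₀, y₀)` lie on `W` with
`Ψ₃(x₀) = 3x₀⁴ + b₂x₀³ + 3b₄x₀² + 3b₆x₀ + b₈ = 0` and `Δ(W) ≠ 0`. Then `2y₀ + a₁x₀ + a₃ ≠ 0`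
(a flex is not a `2`-torsion point), and for the tangent slope `s` — a root of the MONIC
`s² + a₁s − a₂ − 3x₀ = 0` — the change of variables `(1, x₀, s, y₀)` kills `a₂, a₄, a₆`: the new
equation is `y² + a₁'xy + a₃'y = x³` (flex at the origin with tangent `y = 0`; `a₆' = 0` is the
curve equation, `a₄' = 0` the tangency, `a₂' = 0` the flex condition `Ψ₃(x₀) = 0` through
`b₈' = Ψ₃(x₀)`). The characteristic-zero hypothesis is not used.
[cite: SilvermanAEC2009, III.1 and Ex. 3.7] -/
theorem stub_flexAlgebra :
    ∀ {F : Type*} [Field F] [CharZero F] (W : WeierstrassCurve F) (x₀ y₀ : F), W.Δ ≠ 0 →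
      y₀ ^ 2 + W.a₁ * x₀ * y₀ + W.a₃ * y₀ = x₀ ^ 3 + W.a₂ * x₀ ^ 2 + W.a₄ * x₀ + W.a₆ →
      3 * x₀ ^ 4 + W.b₂ * x₀ ^ 3 + 3 * W.b₄ * x₀ ^ 2 + 3 * W.b₆ * x₀ + W.b₈ = 0 →
      2 * y₀ + W.a₁ * x₀ + W.a₃ ≠ 0 ∧
      ∃ s : F, s ^ 2 + W.a₁ * s - W.a₂ - 3 * x₀ = 0 ∧
        ((⟨1, x₀, s, y₀⟩ : VariableChange F) • W).a₂ = 0 ∧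
        ((⟨1, x₀, s, y₀⟩ : VariableChange F) • W).a₄ = 0 ∧
        ((⟨1, x₀, s, y₀⟩ : VariableChange F) • W).a₆ = 0 := by
  intro F _ _ W x₀ y₀ hΔ hE hΨ
  -- (ii) `D = 2y₀ + a₁x₀ + a₃ ≠ 0`: otherwise `(1, x₀, 0, y₀) • W` has `a₃ = a₆ = b₈ = 0`,
  -- hence `Δ = 0`.
  have hD : 2 * y₀ + W.a₁ * x₀ + W.a₃ ≠ 0 := by
    intro hD
    apply hΔ
    rw [← shift_variableChange_Δ W x₀ 0 y₀]
    refine Δ_eq_zero_of_a₃_a₆_b₈ ?_ (shift_variableChange_a₆_eq_zero W 0 x₀ y₀ hE)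
      (shift_variableChange_b₈_eq_zero W 0 y₀ x₀ hΨ)
    rw [shift_variableChange_a₃]
    linear_combination hD
  -- (iii) the tangent slope `s = N / D`
  obtain ⟨s, hs⟩ : ∃ s : F, s * (2 * y₀ + W.a₁ * x₀ + W.a₃) =
      3 * x₀ ^ 2 + 2 * W.a₂ * x₀ + W.a₄ - W.a₁ * y₀ :=
    ⟨_, div_mul_cancel₀ _ hD⟩
  have h3 : ((⟨1, x₀, s, y₀⟩ : VariableChange F) • W).a₃ = 2 * y₀ + W.a₁ * x₀ + W.a₃ := by
    rw [shift_variableChange_a₃]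
    ring
  have h4 : ((⟨1, x₀, s, y₀⟩ : VariableChange F) • W).a₄ = 0 := by
    rw [shift_variableChange_a₄]
    linear_combination -hs
  have h6 : ((⟨1, x₀, s, y₀⟩ : VariableChange F) • W).a₆ = 0 :=
    shift_variableChange_a₆_eq_zero W s x₀ y₀ hE
  have h8 : ((⟨1, x₀, s, y₀⟩ : VariableChange F) • W).b₈ = 0 :=
    shift_variableChange_b₈_eq_zero W s y₀ x₀ hΨ
  have h2 : ((⟨1, x₀, s, y₀⟩ : VariableChange F) • W).a₂ = 0 :=
    a₂_eq_zero_of_a₄_a₆_b₈ (h3.trans_ne hD) h4 h6 h8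
  refine ⟨hD, s, ?_, h2, h4, h6⟩
  -- the monic relation is `−a₂' = 0`
  rw [shift_variableChange_a₂] at h2
  linear_combination -h2

end Summit.ABC.ABC.Theorems

end
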